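import Summits.Ventures.Crystal3D.Theorems.StickyWulffConstantCoaxialWallLawSeamGlideCensusChecker
import Summits.Ventures.Crystal3D.Theorems.StickyWulffConstantCoaxialWallLawSeamFullCensusCert
import Summits.Ventures.Crystal3D.Theorems.StickyWulffConstantCoaxialWallLawSeamCapRow
import HarnessLib

/-!
# GLIDE-CENSUS SOUNDNESS: the interpretation of checker states at a GLIDE end and the soundness of `runG`
# (crux `CoaxialWallLaw`, stmt-Ventures-19481; lane F 'Certificates' v8.7, registered stub `stub_satCensus11Glide : TailResidue.SatCensus11Glide`)

HONEST FRAMING. Venture `Summits/Ventures/Crystal3D` (cell `crystal3d-full`); helper for `stub_satCensus11Glide`; sequel of '…SeamGlideCensusChecker', the GLIDE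
analogue of '…SeamFullCensusSoundA' / '…SeamFullCensusSound' (seat 19481-p2 g15), whose kit it reuses (`T`/`TT`, `e1_step`, `false_of_sep/gap/twelve_contacts`,
the frame tables `tabOK_tabs`, the model reflections `Msym`/`msym`).  The global hypotheses `HypG` carry E1, GAP(5/2), `VacancyCapTwin` and the three NEW
certificate-shaped inputs of the GLIDE piece: **`HexVacancyCap := CapRow T6`** (the hexagon neighbour of a ¼-holed in-layer vacancy cannot be completed to twelve
contacts; numerics of record kit j336825: margin 0.0356), **`HexBlockedCap := CapRow T6b`** (the same ball when the pocket ball `b + (7/3,−8/3,7/3)` blocks the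
refill; kit j337023: margin 0.0486) and **`GlidePocketCap`** (a ball touching the glide target inside one of the two residual cavity templates cannot be completed
to twelve contacts; kit j337021: margin 0.0353 on template F, template A has no admissible position at all, j337020).
* `InvG` — interpretation of a state; `inv_addFullG` / `inv_addTwinG` / `inv_satG` / `inv_unsG` / `inv_insertG` / `inv_empG` — bookkeeping;
* `false_of_checkWG` — witnessed conflicts (the leaves, `runG_sound` and the certificate are in parts B/C and '…SeamGlideCensusCert').
WHAT THIS IS NOT: no certificate is checked here (that is '…SeamGlideCensusCert'); the inputs stay named; F-C1 not moved.
-/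

noncomputable section

namespace Summit.Ventures.Crystal3D.Theorems

namespace TailResidue

namespace GlideCensus

open Summit.Ventures.Crystal3D Finset EndRowFloor NearIdentity FullCensus
open scoped InnerProductSpace

variable {X : Finset (EuclideanSpace ℝ (Fin 3))} {G' : EuclideanSpace ℝ (Fin 3) ≃ₗᵢ[ℝ] EuclideanSpace ℝ (Fin 3)} {q₀ : EuclideanSpace ℝ (Fin 3)}

attribute [local irreducible] insertV addAll fullList ownList mirList farList tabs

/-! ### §1 The three new named inputs -/

/-- **The hex-vacancy template `T6`**: the six unit contacts `Qr (iptQ (c6 a))` of the hexagon ball, one obstacle `Qr (iptQ v6)` (the vacant in-layer slot) of radius `1/4`. -/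
def T6 : CapTemplate 6 1 where
  c a := Qr (iptQ (c6 (a : ℕ)).toV)
  o _ := Qr (iptQ v6.toV)
  r _ := 1 / 4

/-- **The hex-blocked template `T6b`**: the same six contacts, one obstacle `Qr (iptQ o6)` (a present pocket ball blocking the refill of the vacant slot) of radius `1`. -/
def T6b : CapTemplate 6 1 where
  c a := Qr (iptQ (c6 (a : ℕ)).toV)
  o _ := Qr (iptQ o6.toV)
  r _ := 1

/-- **HEX-BLOCKED CAP (named input, certificate-shaped)** = `CapRow T6b`: a ball with the six template contacts and the pocket ball present at the template
position has at most eleven contacts.  Numerics of record: kit j336787 (refuter of every rigid GLIDE leaf, margin 0.061) / j337023 (minimal template). -/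
def HexBlockedCap : Prop := CapRow T6b

/-- **HEX-VACANCY CAP (named input, certificate-shaped)** = `CapRow T6`: a ball with the six template contacts (the type-II closed star + one polar neighbour)
whose further contacts all avoid the ¼-ball at the adjacent vacant in-layer slot has at most eleven contacts.  Numerics of record: kit j336825 (max-min slack
of a completion −0.0356; −0.0327 already for the bare five-ball star). -/
def HexVacancyCap : Prop := CapRow T6

/-- Obstacle condition on the (saturated) pocket ball w.r.t. a template ball, by kind: `0` known dozen (`≥ 5/4`, it cannot be touched), otherwise `= 1 ∨ ≥ 5/4` (GAP at
the pocket ball). -/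
def ObstCond (kind : ℕ) (d : ℝ) : Prop := if kind = 0 then 5 / 4 ≤ d else d = 1 ∨ 5 / 4 ≤ d

/-- Condition on a further contact of the pocket ball w.r.t. an obstacle: kinds `0`, `1`: `= 1 ∨ ≥ 5/4`; otherwise `≥ 1`. -/
def ObstCond' (kind : ℕ) (d : ℝ) : Prop := if kind = 0 ∨ kind = 1 then d = 1 ∨ 5 / 4 ≤ d else 1 ≤ d

/-- The pocket row of a template `(obstacles with kinds, excluded positions)` (model triples relative to the centre `z`), in isometry form. -/
def PocketRow (obst : List (Q3 × ℕ)) (pins : List Q3) : Prop :=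
  ∀ (A : EuclideanSpace ℝ (Fin 3) ≃ₗᵢ[ℝ] EuclideanSpace ℝ (Fin 3)) (z c : EuclideanSpace ℝ (Fin 3)) (N : Finset (EuclideanSpace ℝ (Fin 3))),
    dist c z = 1 →
    (∀ ok ∈ obst, c ≠ z + A (Qr (iptQ ok.1.toV)) ∧ ObstCond ok.2 (dist c (z + A (Qr (iptQ ok.1.toV))))) →
    (∀ e ∈ pins, c ≠ z + A (Qr (iptQ e.toV))) →
    (∀ x ∈ N, dist x c = 1 ∧ x ≠ z ∧ 1 ≤ dist x z ∧ ∀ ok ∈ obst, x ≠ z + A (Qr (iptQ ok.1.toV)) ∧ ObstCond' ok.2 (dist x (z + A (Qr (iptQ ok.1.toV))))) →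
    (∀ x ∈ N, ∀ x' ∈ N, x ≠ x' → 1 ≤ dist x x') →
    N.card + (obst.filter fun ok => dist c (z + A (Qr (iptQ ok.1.toV))) = 1).length ≤ 10

/-- **GLIDE POCKET CAP (named input, certificate-shaped)**: the pocket rows of the two residual cavity templates of the GLIDE engine (family A: lower divacancy
next to the designated unsaturated lower neighbour; family F: the same with the in-layer divacancy) — a ball touching the glide target `z` in the cavity (at the
stated distances from the template balls, not at a decided position) has at most ten further contacts.  Numerics of record: kit j336894. -/
def GlidePocketCap : Prop := PocketRow pocketObstA pocketPinsA ∧ PocketRow pocketObstF pocketPinsF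

/-! ### §2 Global hypotheses and the interpretation of a state -/

/-- **Global hypotheses** of the GLIDE census situation, read through `TT`. -/
structure HypG (X : Finset (EuclideanSpace ℝ (Fin 3))) (G' : EuclideanSpace ℝ (Fin 3) ≃ₗᵢ[ℝ] EuclideanSpace ℝ (Fin 3)) (q₀ : EuclideanSpace ℝ (Fin 3)) : Prop where
  /-- `1`-separation -/
  sep : ∀ p ∈ X, ∀ p' ∈ X, p ≠ p' → 1 ≤ dist p p'
  /-- E1 -/
  e1 : P5Exhaustion
  /-- GAP(5/2) -/
  gap : KissingGap (5 / 2)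
  /-- the twin vacancy cap certificate -/
  cap : VacancyCapTwin
  /-- the hex-vacancy cap certificate -/
  hex : HexVacancyCap
  /-- the hex-blocked cap certificate -/
  hexb : HexBlockedCap
  /-- the pocket cap certificates -/
  pocket : GlidePocketCap
  /-- the end ball is in `X` -/
  bmem : TT G' q₀ bG ∈ X
  /-- the end ball has exactly eleven contacts -/
  deg : (X.filter fun z => dist (TT G' q₀ bG) z = 1).card = 11
  /-- any two unsaturated contacts of the end ball coincide -/
  one : ∀ y ∈ X, ∀ y' ∈ X, dist (TT G' q₀ bG) y = 1 → dist (TT G' q₀ bG) y' = 1 →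
    (X.filter fun z => dist y z = 1).card ≤ 11 → (X.filter fun z => dist y' z = 1).card ≤ 11 → y = y'

/-- **The interpretation of a checker state** (as '…SeamFullCensusSoundA' `Inv`, end ball `bG`). -/
structure InvG (X : Finset (EuclideanSpace ℝ (Fin 3))) (G' : EuclideanSpace ℝ (Fin 3) ≃ₗᵢ[ℝ] EuclideanSpace ℝ (Fin 3)) (q₀ : EuclideanSpace ℝ (Fin 3)) (st : St) :
    Prop where
  /-- present balls are in `X` -/
  pres : ∀ a ∈ st.pres, TT G' q₀ a ∈ X
  /-- no duplicates -/
  nodup : st.pres.Nodup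
  /-- saturated balls have twelve contacts -/
  sat : ∀ a ∈ st.sat, TT G' q₀ a ∈ X ∧ (X.filter fun z => dist (TT G' q₀ a) z = 1).card = 12
  /-- known dozens: the centre is a saturated ball of `X` and every contact is listed -/
  dzn : ∀ pd ∈ st.dzn, (TT G' q₀ pd.1 ∈ X ∧ (X.filter fun z => dist (TT G' q₀ pd.1) z = 1).card = 12) ∧
    ∀ z ∈ X, dist (TT G' q₀ pd.1) z = 1 → ∃ u ∈ pd.2, z = TT G' q₀ u
  /-- listed dozen balls are present -/
  dznPres : ∀ pd ∈ st.dzn, ∀ u ∈ pd.2, u ∈ st.pres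
  /-- saturated balls are present -/
  satPres : ∀ a ∈ st.sat, a ∈ st.pres
  /-- dozen centres are saturated -/
  dznSat : ∀ pd ∈ st.dzn, pd.1 ∈ st.sat
  /-- empty positions -/
  emp : ∀ a ∈ st.emp, TT G' q₀ a ∉ X
  /-- the designated ball is an unsaturated contact of the end ball -/
  uns : ∀ u, st.uns = some u → u ∈ st.pres ∧ Q3.d2 bG u = 18 ∧ (X.filter fun z => dist (TT G' q₀ u) z = 1).card ≤ 11

/-! ### §3 Witnessed conflicts -/

open scoped Classical in
/-- Witnessed conflicts are contradictions. -/
theorem false_of_checkWG (hyp : HypG X G' q₀) {st : St} (hinv : InvG X G' q₀ st) : ∀ w : Witness, checkWG st w = true → False := by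
  intro w hw
  cases w with
  | sep u v =>
    simp only [checkWG, Bool.and_eq_true, decide_eq_true_eq] at hw
    obtain ⟨⟨⟨hu, hv⟩, hne⟩, hlt⟩ := hw
    refine false_of_sep G' q₀ hyp.sep (hinv.pres u hu) (hinv.pres v hv) (fun h => hne (Q3.toV_injective h)) ?_
    rw [Q3.dq_toV_sub]; exact hlt
  | emp u =>
    simp only [checkWG, Bool.and_eq_true, decide_eq_true_eq] at hw
    exact hinv.emp u hw.2 (hinv.pres u hw.1)
  | dzn p x =>
    simp only [checkWG, Bool.and_eq_true, decide_eq_true_eq, List.any_eq_true, Bool.not_eq_true', decide_eq_false_iff_not] at hw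
    obtain ⟨⟨hx, hd⟩, pd, hpd, hp1, hnot⟩ := hw
    have hdist : dist (TT G' q₀ pd.1) (TT G' q₀ x) = 1 := by rw [dist_TT_eq_one_iff, hp1, Q3.d2_comm]; exact hd
    obtain ⟨u, hu, he⟩ := (hinv.dzn pd hpd).2 _ (hinv.pres x hx) hdist
    exact hnot ((TT_injective G' q₀ he) ▸ hu)
  | gap p x =>
    simp only [checkWG, Bool.and_eq_true, decide_eq_true_eq] at hw
    obtain ⟨⟨⟨hp, hx⟩, hlo⟩, hhi⟩ := hw
    obtain ⟨hpX, hp12⟩ := hinv.sat p hp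
    refine false_of_gap G' q₀ hyp.gap hyp.sep hpX hp12 (hinv.pres x hx) ?_ ?_ <;> rw [Q3.dq_toV_sub]
    exacts [hlo, hhi]
  | count =>
    simp only [checkWG, decide_eq_true_eq] at hw
    set L := st.pres.filter fun v => decide (Q3.d2 bG v = 18) with hL
    refine false_of_twelve_contacts G' q₀ (L.map Q3.toV) ((List.nodup_map_iff Q3.toV_injective).2 (hinv.nodup.filter _)) (by simpa using hw)
      (fun v hv => ?_) (fun v hv => ?_) hyp.deg
    · obtain ⟨a, ha, rfl⟩ := List.mem_map.1 hv
      exact hinv.pres a (List.mem_filter.1 ha).1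
    · obtain ⟨a, ha, rfl⟩ := List.mem_map.1 hv
      rw [Q3.dq_toV_sub]; exact of_decide_eq_true (List.mem_filter.1 ha).2

/-! ### §4 Bookkeeping preserves the interpretation -/

/-- The star test of the checker gives the star hypothesis of `e1_step`. -/
theorem star_of_starOKG {st : St} (hinv : InvG X G' q₀ st) {κ : List ℕ} {p : Q3} {j : Fin 12} (h : starOK st (tabs κ) p j = true) :
    ∀ i : Fin 12, 0 < dz (slotInt i) (slotInt j) → T G' q₀ (p.toV + (frameOf κ).g i) ∈ X := by
  intro i hi
  simp only [starOK, List.all_eq_true, List.mem_range, Bool.or_eq_true, Bool.not_eq_true', decide_eq_false_iff_not, decide_eq_true_eq] at h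
  rcases h i i.2 with h | h
  · exfalso; apply h; rw [ss_eq]; exact_mod_cast hi
  · rw [← TT_add_gOf]; exact hinv.pres _ h

/-- **FULL bookkeeping.** -/
theorem inv_addFullG {st : St} (hinv : InvG X G' q₀ st) {κ : List ℕ} {p : Q3} (hp : p ∈ st.sat)
    (hall : ∀ i : Fin 12, T G' q₀ (p.toV + (frameOf κ).g i) ∈ X)
    (hcont : ∀ z ∈ X, dist (T G' q₀ p.toV) z = 1 → ∃ i : Fin 12, z = T G' q₀ (p.toV + (frameOf κ).g i)) : InvG X G' q₀ (addFull st p κ) where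
  pres := by
    intro a ha
    rcases mem_addAll.1 ha with ha | ha
    · exact hinv.pres a ha
    · obtain ⟨i, rfl⟩ := mem_fullList.1 ha
      rw [TT_add_gOf]; exact hall i
  nodup := nodup_addAll hinv.nodup
  sat := hinv.sat
  dzn := by
    intro pd hpd
    rcases List.mem_cons.1 hpd with rfl | hpd
    · refine ⟨hinv.sat p hp, fun z hz hd => ?_⟩
      obtain ⟨i, rfl⟩ := hcont z hz hd
      exact ⟨Q3.add p (gOf (tabs κ) i), mem_fullList.2 ⟨i, rfl⟩, (TT_add_gOf κ p i).symm⟩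
    · exact hinv.dzn pd hpd
  dznPres := by
    intro pd hpd u hu
    rcases List.mem_cons.1 hpd with rfl | hpd
    · exact mem_addAll.2 (Or.inr hu)
    · exact mem_addAll.2 (Or.inl (hinv.dznPres pd hpd u hu))
  satPres := fun a ha => mem_addAll.2 (Or.inl (hinv.satPres a ha))
  dznSat := by
    intro pd hpd
    rcases List.mem_cons.1 hpd with rfl | hpd
    · exact hp
    · exact hinv.dznSat pd hpd
  emp := hinv.emp
  uns := fun u hu => let h := hinv.uns u hu; ⟨mem_addAll.2 (Or.inl h.1), h.2⟩

/-- **TWIN bookkeeping.** -/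
theorem inv_addTwinG {st : St} (hinv : InvG X G' q₀ st) {κ : List ℕ} {p : Q3} (hp : p ∈ st.sat) {c : Fin 8}
    (hown : ∀ i : Fin 12, dz (slotInt i) (cubeInt c) ≤ 0 → T G' q₀ (p.toV + (frameOf κ).g i) ∈ X)
    (hmir : ∀ i : Fin 12, dz (slotInt i) (cubeInt c) < 0 → T G' q₀ (p.toV + mirQ (frameOf κ).g (frameOf κ).w i c) ∈ X)
    (hfar : ∀ i : Fin 12, 0 < dz (slotInt i) (cubeInt c) → T G' q₀ (p.toV + (frameOf κ).g i) ∉ X)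
    (hcont : ∀ z ∈ X, dist (T G' q₀ p.toV) z = 1 →
      (∃ i : Fin 12, dz (slotInt i) (cubeInt c) ≤ 0 ∧ z = T G' q₀ (p.toV + (frameOf κ).g i)) ∨
      (∃ i : Fin 12, dz (slotInt i) (cubeInt c) < 0 ∧ z = T G' q₀ (p.toV + mirQ (frameOf κ).g (frameOf κ).w i c))) :
    InvG X G' q₀ (addTwin st p κ c) where
  pres := by
    intro a ha
    rcases mem_addAll.1 ha with ha | ha
    · exact hinv.pres a ha
    · rcases List.mem_append.1 ha with ha | ha
      · obtain ⟨i, hi, rfl⟩ := mem_ownList.1 ha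
        rw [TT_add_gOf]
        refine hown i ?_
        have := of_decide_eq_true hi; rw [sc_eq] at this; exact_mod_cast this
      · obtain ⟨i, hi, rfl⟩ := mem_mirList.1 ha
        rw [TT_add_mir3]
        refine hmir i ?_
        have := of_decide_eq_true hi; rw [sc_eq] at this; exact_mod_cast this
  nodup := nodup_addAll hinv.nodup
  sat := hinv.sat
  dzn := by
    intro pd hpd
    rcases List.mem_cons.1 hpd with rfl | hpd
    · refine ⟨hinv.sat p hp, fun z hz hd => ?_⟩
      rcases hcont z hz hd with ⟨i, hi, rfl⟩ | ⟨i, hi, rfl⟩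
      · refine ⟨Q3.add p (gOf (tabs κ) i), List.mem_append.2 (Or.inl (mem_ownList.2 ⟨i, ?_, rfl⟩)), (TT_add_gOf κ p i).symm⟩
        rw [decide_eq_true_iff, sc_eq]; exact_mod_cast hi
      · refine ⟨Q3.add p (mir3 (tabs κ) i c), List.mem_append.2 (Or.inr (mem_mirList.2 ⟨i, ?_, rfl⟩)), (TT_add_mir3 κ p i c).symm⟩
        rw [decide_eq_true_iff, sc_eq]; exact_mod_cast hi
    · exact hinv.dzn pd hpd
  dznPres := by
    intro pd hpd u hu
    rcases List.mem_cons.1 hpd with rfl | hpd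
    · exact mem_addAll.2 (Or.inr hu)
    · exact mem_addAll.2 (Or.inl (hinv.dznPres pd hpd u hu))
  satPres := fun a ha => mem_addAll.2 (Or.inl (hinv.satPres a ha))
  dznSat := by
    intro pd hpd
    rcases List.mem_cons.1 hpd with rfl | hpd
    · exact hp
    · exact hinv.dznSat pd hpd
  emp := by
    intro a ha
    rcases List.mem_append.1 ha with ha | ha
    · obtain ⟨i, hi, rfl⟩ := mem_farList.1 ha
      rw [TT_add_gOf]
      refine hfar i ?_
      have := of_decide_eq_true hi; rw [sc_eq] at this; exact_mod_cast this
    · exact hinv.emp a ha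
  uns := fun u hu => let h := hinv.uns u hu; ⟨mem_addAll.2 (Or.inl h.1), h.2⟩

/-- Marking a contact with twelve contacts as saturated. -/
theorem inv_satG {st : St} (hinv : InvG X G' q₀ st) {x : Q3} (hxp : x ∈ st.pres) (hx : TT G' q₀ x ∈ X)
    (h12 : (X.filter fun z => dist (TT G' q₀ x) z = 1).card = 12) : InvG X G' q₀ { st with sat := x :: st.sat } where
  pres := hinv.pres
  nodup := hinv.nodup
  sat := by
    intro a ha
    rcases List.mem_cons.1 ha with rfl | ha
    · exact ⟨hx, h12⟩
    · exact hinv.sat a ha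
  dzn := hinv.dzn
  dznPres := hinv.dznPres
  satPres := by
    intro a ha
    rcases List.mem_cons.1 ha with rfl | ha
    · exact hxp
    · exact hinv.satPres a ha
  dznSat := fun pd hpd => List.mem_cons.2 (Or.inr (hinv.dznSat pd hpd))
  emp := hinv.emp
  uns := hinv.uns

/-- Designating an unsaturated contact of the end ball. -/
theorem inv_unsG {st : St} (hinv : InvG X G' q₀ st) {x : Q3} (hxp : x ∈ st.pres) (hd : Q3.d2 bG x = 18)
    (h11 : (X.filter fun z => dist (TT G' q₀ x) z = 1).card ≤ 11) : InvG X G' q₀ { st with uns := some x } where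
  pres := hinv.pres
  nodup := hinv.nodup
  sat := hinv.sat
  dzn := hinv.dzn
  dznPres := hinv.dznPres
  satPres := hinv.satPres
  dznSat := hinv.dznSat
  emp := hinv.emp
  uns := by intro u hu; cases hu; exact ⟨hxp, hd, h11⟩

/-- Adding one present ball. -/
theorem inv_insertG {st : St} (hinv : InvG X G' q₀ st) {x : Q3} (hx : TT G' q₀ x ∈ X) : InvG X G' q₀ { st with pres := insertV x st.pres } where
  pres := by
    intro a ha
    rcases mem_insertV.1 ha with rfl | ha
    · exact hx
    · exact hinv.pres a ha
  nodup := nodup_insertV hinv.nodup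
  sat := hinv.sat
  dzn := hinv.dzn
  dznPres := fun pd hpd u hu => mem_insertV.2 (Or.inr (hinv.dznPres pd hpd u hu))
  satPres := fun a ha => mem_insertV.2 (Or.inr (hinv.satPres a ha))
  dznSat := hinv.dznSat
  emp := hinv.emp
  uns := fun u hu => let h := hinv.uns u hu; ⟨mem_insertV.2 (Or.inr h.1), h.2⟩

/-- Recording one absent position. -/
theorem inv_empG {st : St} (hinv : InvG X G' q₀ st) {x : Q3} (hx : TT G' q₀ x ∉ X) : InvG X G' q₀ { st with emp := x :: st.emp } where
  pres := hinv.pres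
  nodup := hinv.nodup
  sat := hinv.sat
  dzn := hinv.dzn
  dznPres := hinv.dznPres
  satPres := hinv.satPres
  dznSat := hinv.dznSat
  emp := by
    intro a ha
    rcases List.mem_cons.1 ha with rfl | ha
    · exact hx
    · exact hinv.emp a ha
  uns := hinv.uns

end GlideCensus

end TailResidue

end Summit.Ventures.Crystal3D.Theorems

end
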